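import Summits.QuantumFields.GaugeBoot.Rows.KZL2HD3YCol
import Summits.QuantumFields.GaugeBoot.Rows.KZL2HD3HTab
import Summits.QuantumFields.GaugeBoot.Rows.RedEnc
import HarnessLib

/-!
# Gauge-boot: kernel check of the REDUCTION IDENTITY of the kz-L2-H-3D problems, block 5 second half (part 7/18)

Cell `pub-gaugeboot` (HOME `run/shared/lean/pub/pub-gaugeboot/`), seat lean1 (torus layer for rows C1–C2 (and C41–C50) = the certified
kz-L2-H-3D windows: label set, raw blocks, class/witness tables, the reduction identity, per-β bindings).

HONEST FRAMING (page 1 of every file of this cell): certified bounds on lattice expectations at STATED coupling,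
gauge group, dimension and torus size; NOT a mass gap, NOT a continuum limit, NOT a string tension, NOT large `N`.
The venture is explicitly NOT Yang–Mills-summit-bearing (barriers `FixedCouplingUltralocality`,
`PerturbativeInvisibility`).

For each listed block `k` and `i ≤ j < bdim k` in the stated rectangles: the expansion of `(Y_k)ᵢᵀ · cls · (Y_k)ⱼ` over the raw
class table of the block's family (`hcls` / `scls` / `lcls`) EQUALS, as an integer linear form in the 1203 variables, lean3's
transcription `Certificates.KZL2HD3.ent k i j` of the problem files' entry — checked through the radix-`2^20` encoding `RedEnc.encCheck`
(one big-integer identity per entry, `decide +kernel` on index rectangles of ≤ 40000 expansion terms); assemblies `red_ok_k`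
(`i ≤ j`) + range facts `ycol_lt_k` sit with a block's last rectangle, or in `KZL2HD3RedAsm` when a block spans parts.  Consumed by `KZL2HD3Red`.
-/

set_option Elab.async false

noncomputable section

open Literature.MathematicalPhysics.QuantumFieldTheory

namespace Summit.QuantumFields.GaugeBoot

namespace KZL2HD3

set_option maxHeartbeats 0 in
/-- Reduction identity (kz-L2-H-3D), block 5, rows `2 ≤ i < 3`, columns `max i 6 ≤ j < 7` (9216 expansion terms; kernel). -/
theorem red_ok_5_4 : ∀ i j : Fin 7, 2 ≤ i.val → i.val < 3 → 6 ≤ j.val → j.val < 7 → i.val ≤ j.val →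
    RedEnc.encCheck 20 1203 (KZL2HD3.ycol 5 i) (KZL2HD3.ycol 5 j) (fun a b => (KZL2HD3.hcls a b).val) (Certificates.KZL2HD3.ent 5 i j) = true := by
  decide +kernel

set_option maxHeartbeats 0 in
/-- Reduction identity (kz-L2-H-3D), block 5, rows `3 ≤ i < 4`, columns `max i 0 ≤ j < 7` (36864 expansion terms; kernel). -/
theorem red_ok_5_5 : ∀ i j : Fin 7, 3 ≤ i.val → i.val < 4 → 0 ≤ j.val → j.val < 7 → i.val ≤ j.val →
    RedEnc.encCheck 20 1203 (KZL2HD3.ycol 5 i) (KZL2HD3.ycol 5 j) (fun a b => (KZL2HD3.hcls a b).val) (Certificates.KZL2HD3.ent 5 i j) = true := by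
  decide +kernel

set_option maxHeartbeats 0 in
/-- Reduction identity (kz-L2-H-3D), block 5, rows `4 ≤ i < 5`, columns `max i 0 ≤ j < 7` (27648 expansion terms; kernel). -/
theorem red_ok_5_6 : ∀ i j : Fin 7, 4 ≤ i.val → i.val < 5 → 0 ≤ j.val → j.val < 7 → i.val ≤ j.val →
    RedEnc.encCheck 20 1203 (KZL2HD3.ycol 5 i) (KZL2HD3.ycol 5 j) (fun a b => (KZL2HD3.hcls a b).val) (Certificates.KZL2HD3.ent 5 i j) = true := by
  decide +kernel

set_option maxHeartbeats 0 in
/-- Reduction identity (kz-L2-H-3D), block 5, rows `5 ≤ i < 7`, columns `max i 0 ≤ j < 7` (27648 expansion terms; kernel). -/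
theorem red_ok_5_7 : ∀ i j : Fin 7, 5 ≤ i.val → i.val < 7 → 0 ≤ j.val → j.val < 7 → i.val ≤ j.val →
    RedEnc.encCheck 20 1203 (KZL2HD3.ycol 5 i) (KZL2HD3.ycol 5 j) (fun a b => (KZL2HD3.hcls a b).val) (Certificates.KZL2HD3.ent 5 i j) = true := by
  decide +kernel

end KZL2HD3

end Summit.QuantumFields.GaugeBoot

end
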